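import Summits.BirchSwinnertonDyer.BirchSwinnertonDyer.Theses.ShaPrimaryTransfer
import Literature.NumberTheory.EllipticCurves.SelmerCorankIsogenyProofs
import Literature.NumberTheory.EllipticCurves.TwoIsogenyShaTwoTorsion
import Literature.NumberTheory.EllipticCurves.IwasawaLeadingTermProofs

/-!
# BirchSwinnertonDyer / ShaPrimaryTransfer — crux `FiniteShaComponentTransfer` (stmt-BirchSwinnertonDyer-22356):
# the door datum `t_p(E) = 0` and the transfer are ISOGENY INVARIANTS (unconditional)

Fourth helper file of prover seat `bsd-line-spt-p1` (`--supports stmt-22356 --as helper`). The route's crux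
T = `FiniteShaComponentTransfer` («`t_p(E) = 0 → t_q(E) = 0`», `t_p(E) = corank_{ℤ_p} Ш(E)[p^∞] = W.shaCorank p`)
and its door O = `OneFiniteShaComponent` are stated per Weierstrass model; the companion `…Sectors` records that
`t_p` is an ISOMORPHISM invariant (so T may be read on global minimal models). This file records the stronger,
equally unconditional fact the tree now proves — `t_p` is an invariant of the `ℚ`-ISOGENY CLASS
(`WeierstrassCurve.IsIsogenous.shaCorank_eq`, file `SelmerCorankIsogenyProofs`: for a `K`-isogeny `φ` of degree
`n` with dual `ψ`, `Ш(ψ) ∘ Ш(φ) = n` makes `Ш(E)[p^∞] → Ш(E')[p^∞]` a quasi-isomorphism, and `Ш[p]` is finite by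
weak Mordell–Weil; Greenberg LNM 1716 §1, Milne *ADT* I.7.1(b)) — and what it does for the route's INSTRUMENT:

* §1 `t_p(E) = 0 ↔ t_p(E') = 0` and `Ш(E)[p^∞]` finite ↔ `Ш(E')[p^∞]` finite for `ℚ`-isogenous elliptic
  `E ~ E'` (`shaCorank_eq_zero_iff_of_isIsogenous`, `finite_sha_primary_iff_of_isIsogenous`); the per-curve
  transfer statement and the per-curve door are isogeny invariants (`transferAt_iff_of_isIsogenous`,
  `door_iff_of_isIsogenous`).
* §2 THE DOOR OPENS ANYWHERE IN THE ISOGENY CLASS. Complete `p`-descent decides `Ш(E')[p] = 0` on ONE curve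
  `E'` of the class; that already gives `t_p(E) = 0` for EVERY `E ~ E'`
  (`shaCorank_eq_zero_of_isIsogenous_of_noPTorsion`), although `Ш(E)[p]` itself is NOT an isogeny invariant
  (Cassels' isogeny formula moves `p`-torsion of `Ш` across a `p`-isogeny). So the door O at `p₀` for `E` is
  decided by the cheapest descent available in the class (e.g. on the curve with full rational `2`-torsion for
  `p₀ = 2`), and granting T the datum propagates to every prime of every isogenous curve
  (`shaCorank_eq_zero_of_isIsogenous_of_transfer`).
* §3 In Selmer coordinates (`…RepairCensus` §1) the same invariance reads `corank Sel_{p^∞}(E) = corank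
  Sel_{p^∞}(E')` (`IsIsogenous.selmerCorank_eq`, tree theorem), so «`corank Sel_{p^∞} = rank`» is decided
  class-wide by one descent (`selmerCorank_eq_rank_iff_of_isIsogenous`).

Everything here is unconditional (no named-fact hypothesis); nothing here proves T, O or BSD.

References: R. Greenberg, LNM 1716 (1999), §1 pp. 54–57; J. S. Milne, *Arithmetic Duality Theorems* (2006),
I.7.1(b); J. W. S. Cassels, *Arithmetic on curves of genus 1, VIII*, J. reine angew. Math. 217 (1965) (the
isogeny formula, for the remark that `Ш[p]` is not invariant).
-/

-- D-0017: single-problem summit, so `Summit.BirchSwinnertonDyer.BirchSwinnertonDyer.…` repeats a namespace BY DESIGN.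
set_option linter.dupNamespace false

noncomputable section

namespace Summit.BirchSwinnertonDyer.BirchSwinnertonDyer.Theorems.ShaPrimaryTransferIsogeny

open scoped Classical
open Literature.NumberTheory.EllipticCurves WeierstrassCurve
open Summit.BirchSwinnertonDyer.BirchSwinnertonDyer.Theses.ShaPrimaryTransfer
  (FiniteShaComponentTransfer OneFiniteShaComponent)

variable {W W' : WeierstrassCurve ℚ} [W.IsElliptic] [W'.IsElliptic]

/-! ## §1 The door datum and the per-curve transfer are isogeny invariants -/

/-- **`t_p(E) = 0 ↔ t_p(E') = 0` for `ℚ`-isogenous elliptic curves** (`corank_{ℤ_p} Ш[p^∞]` is an isogeny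
invariant, tree theorem `IsIsogenous.shaCorank_eq`). [cite: Greenberg1999LNM, §1 pp. 54–57]
[cite: MilneADT2006, Ch. I Lemma 7.1(b) (proof), p. 96] -/
theorem shaCorank_eq_zero_iff_of_isIsogenous (h : IsIsogenous W W') (p : ℕ) [Fact p.Prime] :
    W.shaCorank p = 0 ↔ W'.shaCorank p = 0 := by
  rw [h.shaCorank_eq p]

/-- **`Ш(E)[p^∞]` finite ↔ `Ш(E')[p^∞]` finite for `ℚ`-isogenous elliptic curves** (`t_p = 0 ↔ Ш[p^∞]` finite,
tree theorem `finite_primaryComponent_sha_iff_shaCorank_eq_zero`, and §1). [cite: Greenberg1999LNM, §1 pp. 54–57] -/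
theorem finite_sha_primary_iff_of_isIsogenous (h : IsIsogenous W W') (p : ℕ) [Fact p.Prime] :
    Finite (AddCommGroup.primaryComponent W.sha p) ↔ Finite (AddCommGroup.primaryComponent W'.sha p) := by
  rw [finite_primaryComponent_sha_iff_shaCorank_eq_zero W p,
    finite_primaryComponent_sha_iff_shaCorank_eq_zero W' p, h.shaCorank_eq p]

/-- **The per-curve transfer `t_p = 0 ⟹ t_q = 0` is an isogeny invariant**: it holds for `E` iff it holds for
any `ℚ`-isogenous `E'`. [cite: Greenberg1999LNM, §1 pp. 54–57] -/
theorem transferAt_iff_of_isIsogenous (h : IsIsogenous W W') (p q : ℕ) [Fact p.Prime] [Fact q.Prime] :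
    (W.shaCorank p = 0 → W.shaCorank q = 0) ↔ (W'.shaCorank p = 0 → W'.shaCorank q = 0) := by
  rw [h.shaCorank_eq p, h.shaCorank_eq q]

/-- **The per-curve door is an isogeny invariant**: `E` has a prime `p₀` with `t_{p₀}(E) = 0` iff a
`ℚ`-isogenous `E'` has one (the same `p₀` serves). [cite: Greenberg1999LNM, §1 pp. 54–57] -/
theorem door_iff_of_isIsogenous (h : IsIsogenous W W') :
    (∃ (p : ℕ) (_ : Fact p.Prime), W.shaCorank p = 0) ↔ ∃ (p : ℕ) (_ : Fact p.Prime), W'.shaCorank p = 0 := by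
  constructor
  · rintro ⟨p, hp, h0⟩
    exact ⟨p, hp, (shaCorank_eq_zero_iff_of_isIsogenous h p).1 h0⟩
  · rintro ⟨p, hp, h0⟩
    exact ⟨p, hp, (shaCorank_eq_zero_iff_of_isIsogenous h p).2 h0⟩

/-! ## §2 The door opens anywhere in the isogeny class -/

/-- **A complete `p`-descent on ONE curve of the class opens the door for all of them.** If `E ~ E'` over `ℚ`
and `Ш(E')` has no element of order `p` (`Ш(E')[p] = 0`, what a complete `p`-descent with
`dim Sel_p(E') = rank + dim E'(ℚ)[p]` certifies), then `t_p(E) = 0` — although `Ш(E)[p]` itself need not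
vanish (`Ш[p]` is not an isogeny invariant). Tree theorems `shaCorank_eq_zero_of_forall` (no `p`-torsion ⟹
`Ш[p^∞] = 0`) and `IsIsogenous.shaCorank_eq`. [cite: Greenberg1999LNM, §1 pp. 54–57] -/
theorem shaCorank_eq_zero_of_isIsogenous_of_noPTorsion (h : IsIsogenous W W') (p : ℕ) [Fact p.Prime]
    (hW' : ∀ c ∈ W'.sha, p • c = 0 → c = 0) : W.shaCorank p = 0 :=
  (h.shaCorank_eq p).trans (W'.shaCorank_eq_zero_of_forall p hW')

/-- **Granting T, one descent anywhere in the class settles every primary component of every member**: if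
`E ~ E'` over `ℚ`, `Ш(E')[p] = 0`, and T holds, then `t_q(E) = 0` for every prime `q`. CONDITIONAL on `hT`.
[cite: Greenberg1999LNM, §1 pp. 54–57] -/
theorem shaCorank_eq_zero_of_isIsogenous_of_transfer (hT : FiniteShaComponentTransfer)
    (h : IsIsogenous W W') (p q : ℕ) [Fact p.Prime] [Fact q.Prime]
    (hW' : ∀ c ∈ W'.sha, p • c = 0 → c = 0) : W.shaCorank q = 0 :=
  hT W p q (shaCorank_eq_zero_of_isIsogenous_of_noPTorsion h p hW')

/-- **T moves the door datum across the class and the prime at once**: granting T, `t_p(E') = 0` for SOME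
isogenous `E'` and SOME prime `p` gives `t_q(E) = 0` for every `q`. CONDITIONAL on `hT`.
[cite: Greenberg1999LNM, §1 pp. 54–57] -/
theorem shaCorank_eq_zero_of_isIsogenous_of_door_of_transfer (hT : FiniteShaComponentTransfer)
    (h : IsIsogenous W W') {p : ℕ} [Fact p.Prime] (h0 : W'.shaCorank p = 0) (q : ℕ) [Fact q.Prime] :
    W.shaCorank q = 0 :=
  hT W p q ((shaCorank_eq_zero_iff_of_isIsogenous h p).2 h0)

/-! ## §3 Selmer coordinates -/

/-- **«`corank Sel_{p^∞} = rank`» is decided class-wide by one curve**: for `ℚ`-isogenous elliptic `E ~ E'`,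
`corank_{ℤ_p} Sel_{p^∞}(E/ℚ) = rank E(ℚ) ↔ corank_{ℤ_p} Sel_{p^∞}(E'/ℚ) = rank E'(ℚ)` (both Selmer coranks and
both ranks agree: tree theorems `IsIsogenous.selmerCorank_eq`, `IsIsogenous.mordellWeilRank_eq`).
[cite: Greenberg1999LNM, §1 pp. 54–57] -/
theorem selmerCorank_eq_rank_iff_of_isIsogenous (h : IsIsogenous W W') (p : ℕ) [Fact p.Prime] :
    W.selmerCorank p = W.mordellWeilRank ↔ W'.selmerCorank p = W'.mordellWeilRank := by
  rw [h.selmerCorank_eq p, h.mordellWeilRank_eq]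

end Summit.BirchSwinnertonDyer.BirchSwinnertonDyer.Theorems.ShaPrimaryTransferIsogeny
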